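/-
Copyright (c) 2026. All rights reserved.
Released under Apache 2.0 license as described in the file LICENSE.
Authors: abc-iut cell, prover seat abc-iut-w5-d039 (wave 5, gen 7).
-/
import Literature.IUT.LogVolume.UnitLogBallVolumeCriterion
import HarnessLib

/-!
# Which ramified `K/ℚ_p` have `𝒪_K = p^k · log_p(𝒪_K^×)`?  The census: none for `p ≥ 5`; `(e,f) = (2,1)` for
# `p = 3`; `(e,f,m) ∈ {(2,1,1), (2,2,2), (4,1,3)}` for `p = 2`

Proof-only sequel (theorems, no definitions) of `UnitLogBallVolumeCriterion.lean` (this seat: the VOLUME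
constraint `𝒪_K = p^k · log_p(𝒪_K^×) ⇒ m = f·(−k·e − 1)`, `p^m` the order of the `p`-primary torsion of `𝒪_K^×`,
and its evaluation when `m = 0`).  Here the case `m ≥ 1` is bounded by the ramification a root of unity costs:

* `pow_pred_mul_dvd_absRamificationIdx_of_isPrimitiveRoot`: a primitive `p^{n+1}`-th root of unity in `K` forces
  **`p^n·(p − 1) ∣ e(K/ℚ_p)`** (`Φ_{p^{n+1}}(1) = p`, and `‖1 − μ‖` is the same for all primitive `p^{n+1}`-th roots
  `μ`, each being a power of any other); with `exists_isPrimitiveRoot_pow_torsionPExp` (the cyclic group `R^μ`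
  of order `p^m·(q − 1)` contains an element of order `p^m`): **`m ≥ 1 ⇒ p^{m−1}·(p − 1) ∣ e`**
  (`pow_torsionPExp_pred_mul_dvd_absRamificationIdx`);
* the volume constraint gives `e − 1 ≤ m` when `m ≥ 1` (`absRamificationIdx_le_torsionPExp_succ_of_…`), so
  `p^{m−1}(p − 1) ≤ e ≤ m + 1`, which is impossible for `p ≥ 5`, forces `m = 1`, `e = 2`, `f = 1` for `p = 3`,
  and `m ≤ 3` with `(e,f,m) ∈ {(1,1,1), (2,1,1), (2,2,2), (4,1,3)}` for `p = 2`;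
* CENSUS THEOREMS: **`closedBall_one_ne_zpow_smul_logUnits_of_five_le`** (`p ≥ 5`, `e ≥ 2` ⇒ the unit ball is NO
  `p^k · log_p(𝒪_K^×)` — no hypothesis on roots of unity), **`eq_of_closedBall_one_eq_zpow_smul_logUnits_three`**
  (`p = 3`, `e ≥ 2`: only `e = 2 ∧ f = 1 ∧ m = 1 ∧ k = −1`, the shape of `ℚ_3(ζ_3)`, where indeed
  `log_3(𝒪^×) = 3·𝒪`, `UnitLogZetaThree.lean`), **`closedBall_one_ne_zpow_smul_logUnits_three`**,
  **`mem_of_closedBall_one_eq_zpow_smul_logUnits_two`** (`p = 2`: only `(e,f,m,k) ∈ {(1,1,1,−2), (2,1,1,−1),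
  (2,2,2,−1), (4,1,3,−1)}` — `ℚ_2`, and the shapes of the ramified quadratics with `μ = ±1`, of `ℚ_2(ζ_{12})`, of
  `ℚ_2(ζ_8)`), **`closedBall_one_ne_zpow_smul_logUnits_two`**.

For the abc-iut cell's TEAM R record (consumer `Summits/ABC/IUTFork/Thm311RealIsmDHMoverCensus.lean`): by
abc-iut-w5-d180's ball-mover criterion these say at which ramified places the Dupuy–Hilado (Ind2) group can
fix the unit ball at all.  Classical local analysis (Neukirch, *Algebraic Number Theory*, Ch. II (5.5), (5.7),
(7.13); Washington, *Cyclotomic Fields*, Lemma 1.4, Prop. 2.8); [IUTchIV] Prop. 1.4 (ii) enters only through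
`UnitLogVolume.lean`. Nothing here bears on the disputed [IUTchIII] Cor. 3.12. [cite: NeukirchANT1999, Ch. II (5.7), (7.13)]
[cite: WeilBNT1967, Ch. II §2, Th. 1–2]
-/

noncomputable section

open MeasureTheory Set Metric
open scoped Pointwise
open Literature.NumberTheory.GaloisRepresentations.Ultrametric

namespace Literature.IUT.LogVolume

variable (p : ℕ) [Fact p.Prime]
variable (K : Type*) [NontriviallyNormedField K] [instK : NormedAlgebra ℚ_[p] K] [IsUltrametricDist K]
  [ProperSpace K]

/-! ## 1. Prime-power roots of unity cost ramification `p^n·(p − 1)` -/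

omit instK [ProperSpace K] in
/-- Two primitive `N`-th roots of unity `ζ`, `μ` of `K` have `‖1 − μ‖ = ‖1 − ζ‖` (each is a power of the other).
[cite: NeukirchANT1999, Ch. II (7.13)] -/
theorem norm_one_sub_eq_of_isPrimitiveRoot_of_isPrimitiveRoot {N : ℕ} (hN : 0 < N) {ζ μ : K}
    (hζ : IsPrimitiveRoot ζ N) (hμ : IsPrimitiveRoot μ N) : ‖1 - μ‖ = ‖1 - ζ‖ := by
  haveI : NeZero N := ⟨hN.ne'⟩
  have hn1 : ∀ {x : K}, x ^ N = 1 → ‖x‖ ≤ 1 := fun {x} hx => by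
    have h : ‖x‖ ^ N = 1 := by rw [← norm_pow, hx, norm_one]
    exact ((pow_eq_one_iff_of_nonneg (norm_nonneg x) hN.ne').1 h).le
  have hζ1 : ‖ζ‖ ≤ 1 := hn1 hζ.pow_eq_one
  obtain ⟨i, -, rfl⟩ := hζ.eq_pow_of_pow_eq_one hμ.pow_eq_one
  refine le_antisymm (norm_one_sub_pow_le K hζ1 i) ?_
  obtain ⟨i', -, hi'⟩ := hμ.eq_pow_of_pow_eq_one hζ.pow_eq_one
  calc ‖1 - ζ‖ = ‖1 - (ζ ^ i) ^ i'‖ := by rw [hi']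
    _ ≤ ‖1 - ζ ^ i‖ := norm_one_sub_pow_le K (hn1 hμ.pow_eq_one) i'

omit instK [ProperSpace K] in
/-- **`‖1 − ζ‖^{p^n (p−1)} = ‖p‖` for a primitive `p^{n+1}`-th root of unity `ζ ∈ K`** (`Φ_{p^{n+1}}(1) = p`).
[cite: NeukirchANT1999, Ch. II (7.13)] -/
theorem norm_one_sub_pow_eq_norm_prime_of_isPrimitiveRoot_pow {n : ℕ} {ζ : K}
    (hζ : IsPrimitiveRoot ζ (p ^ (n + 1))) : ‖1 - ζ‖ ^ (p ^ n * (p - 1)) = ‖(p : K)‖ := by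
  classical
  have hp : p.Prime := Fact.out
  have hN : 0 < p ^ (n + 1) := pow_pos hp.pos _
  have h1 : Polynomial.eval 1 (Polynomial.cyclotomic (p ^ (n + 1)) K) = (p : K) :=
    Polynomial.eval_one_cyclotomic_prime_pow n
  rw [Polynomial.cyclotomic_eq_prod_X_sub_primitiveRoots hζ, Polynomial.eval_prod] at h1
  simp only [Polynomial.eval_sub, Polynomial.eval_X, Polynomial.eval_C] at h1
  rw [← h1, norm_prod, Finset.prod_congr rfl fun μ hμ =>
    norm_one_sub_eq_of_isPrimitiveRoot_of_isPrimitiveRoot K hN hζ ((mem_primitiveRoots hN).1 hμ),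
    Finset.prod_const, hζ.card_primitiveRoots, Nat.totient_prime_pow_succ hp]

/-- **A primitive `p^{n+1}`-th root of unity in `K` forces `p^n·(p − 1) ∣ e(K/ℚ_p)`** (`K ⊇ ℚ_p(ζ_{p^{n+1}})`,
totally ramified of degree `p^n (p − 1)`). [cite: NeukirchANT1999, Ch. II (7.13)] -/
theorem pow_pred_mul_dvd_absRamificationIdx_of_isPrimitiveRoot {n : ℕ} {ζ : K}
    (hζ : IsPrimitiveRoot ζ (p ^ (n + 1))) : p ^ n * (p - 1) ∣ absRamificationIdx p K := by
  have hp : p.Prime := Fact.out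
  obtain ⟨ϖ, hϖ⟩ := exists_isUniformizer (F := K)
  have hone : 1 < p ^ (n + 1) := Nat.one_lt_pow (Nat.succ_ne_zero n) hp.one_lt
  have hζ1 : (1 : K) - ζ ≠ 0 := sub_ne_zero.2 (hζ.ne_one hone).symm
  obtain ⟨a, ha⟩ := hϖ.2 (Units.mk0 (1 - ζ) hζ1)
  rw [Units.val_mk0] at ha
  have h := norm_one_sub_pow_eq_norm_prime_of_isPrimitiveRoot_pow p K hζ
  rw [ha, norm_prime_eq_norm_pow p K hϖ, ← zpow_natCast, ← zpow_mul, ← zpow_natCast] at h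
  have h' : a * ((p ^ n * (p - 1) : ℕ) : ℤ) = (absRamificationIdx p K : ℤ) := hϖ.zpow_injective h
  exact Int.natCast_dvd_natCast.1 ⟨a, by rw [← h', mul_comm]⟩

/-- **`R^μ` contains a primitive `p^m`-th root of unity, `m = torsionPExp p K`** (`R^μ` is cyclic of order
`p^m·(q − 1)`). [cite: NeukirchANT1999, Ch. II (5.7)] -/
theorem exists_isPrimitiveRoot_pow_torsionPExp : ∃ ζ : K, IsPrimitiveRoot ζ (p ^ torsionPExp p K) := by
  classical
  have hp : p.Prime := Fact.out
  haveI := finite_torsionUnits p K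
  obtain ⟨g, hg⟩ := IsCyclic.exists_ofOrder_eq_natCard (α := torsionUnits K)
  set q1 := p ^ residueDegree p K - 1 with hq1
  have hq10 : q1 ≠ 0 := residueCard_sub_one_ne_zero p K
  have hcard : Nat.card (torsionUnits K) = p ^ torsionPExp p K * q1 := card_torsionUnits p K
  have hdvd : q1 ∣ orderOf g := ⟨p ^ torsionPExp p K, by rw [hg, hcard, mul_comm]⟩
  have hord : orderOf (g ^ q1) = p ^ torsionPExp p K := by
    rw [orderOf_pow_of_dvd hq10 hdvd, hg, hcard, Nat.mul_div_cancel _ (Nat.pos_of_ne_zero hq10)]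
  refine ⟨(((g ^ q1 : torsionUnits K) : Kˣ) : K), ?_⟩
  rw [IsPrimitiveRoot.coe_units_iff, ← hord, ← Subgroup.orderOf_coe (g ^ q1)]
  exact IsPrimitiveRoot.orderOf _

/-- **`m ≥ 1 ⇒ p^{m−1}·(p − 1) ∣ e(K/ℚ_p)`.** [cite: NeukirchANT1999, Ch. II (5.7), (7.13)] -/
theorem pow_torsionPExp_pred_mul_dvd_absRamificationIdx (hm : 1 ≤ torsionPExp p K) :
    p ^ (torsionPExp p K - 1) * (p - 1) ∣ absRamificationIdx p K := by
  obtain ⟨ζ, hζ⟩ := exists_isPrimitiveRoot_pow_torsionPExp p K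
  have hm' : torsionPExp p K = torsionPExp p K - 1 + 1 := (Nat.sub_add_cancel hm).symm
  rw [hm'] at hζ
  exact pow_pred_mul_dvd_absRamificationIdx_of_isPrimitiveRoot p K hζ

/-- `p = 2 ⇒ m ≥ 1` (`−1 ≠ 1` is a unit of order `2`). [cite: NeukirchANT1999, Ch. II (5.7)] -/
theorem one_le_torsionPExp_of_two (hp2 : p = 2) : 1 ≤ torsionPExp p K := by
  haveI := Literature.NumberTheory.Transcendental.IwasawaLog.charZero p (F := K)
  by_contra h
  have h0 : torsionPExp p K = 0 := by omega
  have h1 := forall_pow_prime_eq_one_of_torsionPExp_eq_zero p K h0 (-1) (by rw [hp2]; norm_num)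
  norm_num at h1

/-! ## 2. The volume constraint bounds `e` by `m + 1` -/

/-- **`𝒪_K = p^k · log_p(𝒪_K^×)` with `m ≥ 1` ⇒ `e ≤ m + 1` and `k ≤ −1`** (from `m = f·(−k·e − 1)`:
`−k·e − 1 ≥ 1`, so `−k ≥ 1`, `−k·e ≥ e`, `m ≥ −k·e − 1 ≥ e − 1`). [cite: NeukirchANT1999, Ch. II (5.7)] -/
theorem absRamificationIdx_le_torsionPExp_succ_of_closedBall_one_eq_zpow_smul_logUnits {k : ℤ}
    (h : closedBall (0 : K) 1 = ((p : ℚ_[p]) ^ k) • logUnits K) (hm : 1 ≤ torsionPExp p K) :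
    absRamificationIdx p K ≤ torsionPExp p K + 1 ∧ k ≤ -1 := by
  have H := torsionPExp_eq_of_closedBall_one_eq_zpow_smul_logUnits p K h
  have hf : (1 : ℤ) ≤ residueDegree p K := by exact_mod_cast residueDegree_pos p K
  have he : (1 : ℤ) ≤ absRamificationIdx p K := by exact_mod_cast absRamificationIdx_pos p K
  have hm' : (1 : ℤ) ≤ torsionPExp p K := by exact_mod_cast hm
  set X : ℤ := -(k * absRamificationIdx p K) - 1 with hX
  -- `X ≥ 1`
  have hX1 : 1 ≤ X := by
    by_contra hlt
    push Not at hlt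
    have : (residueDegree p K : ℤ) * X ≤ 0 :=
      mul_nonpos_of_nonneg_of_nonpos (by linarith) (by linarith)
    linarith
  -- `-k ≥ 1`
  have hk : k ≤ -1 := by
    by_contra hlt
    push Not at hlt
    have : 0 ≤ k * absRamificationIdx p K := mul_nonneg (by linarith) (by linarith)
    linarith
  refine ⟨?_, hk⟩
  have h1 : (absRamificationIdx p K : ℤ) ≤ -(k * absRamificationIdx p K) := by nlinarith
  have h2 : X ≤ (residueDegree p K : ℤ) * X := by nlinarith
  have h3 : (absRamificationIdx p K : ℤ) ≤ torsionPExp p K + 1 := by linarith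
  exact_mod_cast h3

/-- `m ≤ 2^{m−1} ≤ p^{m−1}` for `m ≥ 1`. [folklore] -/
private theorem le_prime_pow_pred (m : ℕ) : m ≤ p ^ (m - 1) := by
  have hp : p.Prime := Fact.out
  rcases Nat.eq_zero_or_pos m with rfl | hm
  · simp
  · have h1 : m - 1 < 2 ^ (m - 1) := Nat.lt_two_pow_self
    have h2 : 2 ^ (m - 1) ≤ p ^ (m - 1) := Nat.pow_le_pow_left hp.two_le _
    omega

/-! ## 3. The census -/

/-- **`p ≥ 5`, `e ≥ 2` ⇒ the unit ball `𝒪_K` is NO `p^k · log_p(𝒪_K^×)`** — no hypothesis on the roots of unity of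
`K`: if `m = 0` the volume constraint forces `e = 1`; if `m ≥ 1` then `p^{m−1}(p − 1) ≤ e ≤ m + 1 ≤ p^{m−1} + 1`,
impossible as `p − 1 ≥ 4`. [cite: NeukirchANT1999, Ch. II (5.7), (7.13)] -/
theorem closedBall_one_ne_zpow_smul_logUnits_of_five_le (hp5 : 5 ≤ p) (he : 2 ≤ absRamificationIdx p K)
    (k : ℤ) : closedBall (0 : K) 1 ≠ ((p : ℚ_[p]) ^ k) • logUnits K := by
  intro h
  rcases Nat.eq_zero_or_pos (torsionPExp p K) with hm | hm
  · have h1 := (absRamificationIdx_eq_one_of_closedBall_one_eq_zpow_smul_logUnits p K hm h).1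
    omega
  · have hle := (absRamificationIdx_le_torsionPExp_succ_of_closedBall_one_eq_zpow_smul_logUnits p K h hm).1
    have hdvd := pow_torsionPExp_pred_mul_dvd_absRamificationIdx p K hm
    have hge : p ^ (torsionPExp p K - 1) * (p - 1) ≤ absRamificationIdx p K :=
      Nat.le_of_dvd (absRamificationIdx_pos p K) hdvd
    have hX := le_prime_pow_pred p (torsionPExp p K)
    have h4 : p ^ (torsionPExp p K - 1) * 4 ≤ p ^ (torsionPExp p K - 1) * (p - 1) :=
      Nat.mul_le_mul_left _ (by omega)
    have hpos : 1 ≤ p ^ (torsionPExp p K - 1) := Nat.one_le_pow _ _ (by omega)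
    omega

/-- **`p = 3`, `e ≥ 2`: `𝒪_K = 3^k · log_3(𝒪_K^×)` forces `e = 2`, `f = 1`, `m = 1`, `k = −1`** — the shape of
`ℚ_3(ζ_3)` (where indeed `log_3(𝒪^×) = 3·𝒪`, `UnitLogZetaThree.lean`). [cite: NeukirchANT1999, Ch. II (5.7), (7.13)] -/
theorem eq_of_closedBall_one_eq_zpow_smul_logUnits_three (hp3 : p = 3) (he : 2 ≤ absRamificationIdx p K)
    {k : ℤ} (h : closedBall (0 : K) 1 = ((p : ℚ_[p]) ^ k) • logUnits K) :
    absRamificationIdx p K = 2 ∧ residueDegree p K = 1 ∧ torsionPExp p K = 1 ∧ k = -1 := by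
  subst hp3
  rcases Nat.eq_zero_or_pos (torsionPExp 3 K) with hm | hm
  · have h1 := (absRamificationIdx_eq_one_of_closedBall_one_eq_zpow_smul_logUnits 3 K hm h).1
    omega
  · obtain ⟨hle, hk⟩ := absRamificationIdx_le_torsionPExp_succ_of_closedBall_one_eq_zpow_smul_logUnits 3 K h hm
    have hdvd := pow_torsionPExp_pred_mul_dvd_absRamificationIdx 3 K hm
    have hge : 3 ^ (torsionPExp 3 K - 1) * (3 - 1) ≤ absRamificationIdx 3 K :=
      Nat.le_of_dvd (absRamificationIdx_pos 3 K) hdvd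
    have hX := le_prime_pow_pred 3 (torsionPExp 3 K)
    have hpos : 1 ≤ 3 ^ (torsionPExp 3 K - 1) := Nat.one_le_pow _ _ (by omega)
    -- `2·3^{m-1} ≤ e ≤ m + 1 ≤ 3^{m-1} + 1` forces `3^{m-1} = 1`, `m = 1`, `e = 2`
    have hm1 : torsionPExp 3 K = 1 := by omega
    have he2 : absRamificationIdx 3 K = 2 := by
      rw [hm1] at hge hle
      norm_num at hge
      omega
    have H := torsionPExp_eq_of_closedBall_one_eq_zpow_smul_logUnits 3 K h
    rw [hm1, he2] at H
    push_cast at H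
    have hf : (1 : ℤ) ≤ residueDegree 3 K := by exact_mod_cast residueDegree_pos 3 K
    -- `1 = f * (-2k - 1)` with `k ≤ -1`, `f ≥ 1` ⇒ `k = -1`, `f = 1`
    have hk1 : k = -1 := by nlinarith
    subst hk1
    norm_num at H
    exact ⟨he2, by exact_mod_cast H.symm, hm1, rfl⟩

/-- **`p = 3`, `e ≥ 2`, `(e, f) ≠ (2, 1)` ⇒ the unit ball `𝒪_K` is NO `3^k · log_3(𝒪_K^×)`** (e.g. `e = 3`,
`e ≥ 4`, or `e = 2` with `f ≥ 2`). [cite: NeukirchANT1999, Ch. II (5.7), (7.13)] -/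
theorem closedBall_one_ne_zpow_smul_logUnits_three (hp3 : p = 3) (he : 2 ≤ absRamificationIdx p K)
    (hne : ¬ (absRamificationIdx p K = 2 ∧ residueDegree p K = 1)) (k : ℤ) :
    closedBall (0 : K) 1 ≠ ((p : ℚ_[p]) ^ k) • logUnits K := fun h =>
  let ⟨h1, h2, _, _⟩ := eq_of_closedBall_one_eq_zpow_smul_logUnits_three p K hp3 he h
  hne ⟨h1, h2⟩

/-- **`p = 2`: `𝒪_K = 2^k · log_2(𝒪_K^×)` forces `(e, f, m, k) ∈ {(1,1,1,−2), (2,1,1,−1), (2,2,2,−1), (4,1,3,−1)}`**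
(`ℚ_2` itself, where `log_2(ℤ_2^×) = 4ℤ_2`; the shapes of the ramified quadratic fields with `μ = ±1`, of
`ℚ_2(ζ_{12})`, of `ℚ_2(ζ_8)`): `m ≥ 1`, `2^{m−1} ∣ e`, `e ≤ m + 1` leave `m ≤ 3` and the listed solutions of
`m = f·(−k·e − 1)`. [cite: NeukirchANT1999, Ch. II (5.7), (7.13)] -/
theorem mem_of_closedBall_one_eq_zpow_smul_logUnits_two (hp2 : p = 2) {k : ℤ}
    (h : closedBall (0 : K) 1 = ((p : ℚ_[p]) ^ k) • logUnits K) :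
    (absRamificationIdx p K = 1 ∧ residueDegree p K = 1 ∧ torsionPExp p K = 1 ∧ k = -2) ∨
    (absRamificationIdx p K = 2 ∧ residueDegree p K = 1 ∧ torsionPExp p K = 1 ∧ k = -1) ∨
    (absRamificationIdx p K = 2 ∧ residueDegree p K = 2 ∧ torsionPExp p K = 2 ∧ k = -1) ∨
    (absRamificationIdx p K = 4 ∧ residueDegree p K = 1 ∧ torsionPExp p K = 3 ∧ k = -1) := by
  have hm := one_le_torsionPExp_of_two p K hp2
  obtain ⟨hle, hk⟩ := absRamificationIdx_le_torsionPExp_succ_of_closedBall_one_eq_zpow_smul_logUnits p K h hm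
  have hdvd := pow_torsionPExp_pred_mul_dvd_absRamificationIdx p K hm
  have hepos := absRamificationIdx_pos p K
  have hge : p ^ (torsionPExp p K - 1) * (p - 1) ≤ absRamificationIdx p K := Nat.le_of_dvd hepos hdvd
  have H := torsionPExp_eq_of_closedBall_one_eq_zpow_smul_logUnits p K h
  have hf : 1 ≤ residueDegree p K := residueDegree_pos p K
  subst hp2
  -- `m ≤ 3`: for `m ≥ 4`, `2^{m-1} ≥ m + 2 > e`
  have hm3 : torsionPExp 2 K ≤ 3 := by
    by_contra hlt
    push Not at hlt
    obtain ⟨r, hr⟩ : ∃ r, torsionPExp 2 K - 1 = 3 + r := ⟨torsionPExp 2 K - 1 - 3, by omega⟩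
    have h8 : 2 ^ (torsionPExp 2 K - 1) = 8 * 2 ^ r := by rw [hr, pow_add]; norm_num
    have hr2 : r < 2 ^ r := Nat.lt_two_pow_self
    rw [h8] at hge
    omega
  -- `f ≤ m` and the equation in each case
  generalize absRamificationIdx 2 K = e at *
  generalize residueDegree 2 K = f at *
  generalize torsionPExp 2 K = m at *
  have hX1 : (1 : ℤ) ≤ -(k * e) - 1 := by
    by_contra hlt
    push Not at hlt
    have : (f : ℤ) * (-(k * e) - 1) ≤ 0 := mul_nonpos_of_nonneg_of_nonpos (by positivity) (by linarith)
    have : (1 : ℤ) ≤ m := by exact_mod_cast hm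
    linarith
  have hfm : f ≤ m := by
    have : (f : ℤ) ≤ m := by nlinarith
    exact_mod_cast this
  interval_cases hmv : m
  · -- m = 1
    have he2 : e ≤ 2 := by omega
    have hf1 : f = 1 := by omega
    rw [hf1] at H; push_cast at H
    interval_cases hev : e
    · left; refine ⟨rfl, hf1, rfl, by push_cast at H; omega⟩
    · right; left; refine ⟨rfl, hf1, rfl, by push_cast at H; omega⟩
  · -- m = 2: `2 ∣ e`, `e ≤ 3` ⇒ `e = 2`; then `2 = f (-2k - 1)` ⇒ `f = 2`, `k = -1`
    have he2 : e = 2 := by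
      norm_num at hdvd
      omega
    rw [he2] at H; push_cast at H
    interval_cases hfv : f
    · exfalso; omega
    · right; right; left; exact ⟨he2, rfl, rfl, by omega⟩
  · -- m = 3: `4 ∣ e`, `e ≤ 4` ⇒ `e = 4`; then `3 = f (-4k - 1)` ⇒ `f = 1` or `f = 3`...
    have he4 : e = 4 := by
      norm_num at hdvd
      omega
    rw [he4] at H; push_cast at H
    interval_cases hfv : f
    · right; right; right; exact ⟨he4, rfl, rfl, by omega⟩
    · exfalso; omega
    · exfalso; omega

/-- **`p = 2`, `e ≥ 2`, `(e, f) ∉ {(2,1), (2,2), (4,1)}` ⇒ the unit ball `𝒪_K` is NO `2^k · log_2(𝒪_K^×)`**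
(e.g. `e` odd ≥ 3, `e ≥ 5`, `e = 4 ∧ f ≥ 2`, `e = 2 ∧ f ≥ 3`). [cite: NeukirchANT1999, Ch. II (5.7), (7.13)] -/
theorem closedBall_one_ne_zpow_smul_logUnits_two (hp2 : p = 2) (he : 2 ≤ absRamificationIdx p K)
    (hne : ¬ ((absRamificationIdx p K = 2 ∧ residueDegree p K = 1) ∨
      (absRamificationIdx p K = 2 ∧ residueDegree p K = 2) ∨ (absRamificationIdx p K = 4 ∧ residueDegree p K = 1)))
    (k : ℤ) : closedBall (0 : K) 1 ≠ ((p : ℚ_[p]) ^ k) • logUnits K := by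
  intro h
  rcases mem_of_closedBall_one_eq_zpow_smul_logUnits_two p K hp2 h with
    ⟨h1, -, -, -⟩ | ⟨h1, h2, -, -⟩ | ⟨h1, h2, -, -⟩ | ⟨h1, h2, -, -⟩
  · omega
  · exact hne (Or.inl ⟨h1, h2⟩)
  · exact hne (Or.inr (Or.inl ⟨h1, h2⟩))
  · exact hne (Or.inr (Or.inr ⟨h1, h2⟩))

/-- **`e = 1`, `p = 2`: `𝒪_K = 2^k · log_2(𝒪_K^×)` forces `f = 1`** (the shape of `ℚ_2`) — abc-iut-w5-d180's
`UnitLogUnramifiedDyadic` (`e = 1`, `f ≥ 2` ⇒ `log_2(𝒪^×)` is no ball at all) recovered at the level of `p`-power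
multiples of the unit ball by counting alone. [cite: NeukirchANT1999, Ch. II (5.5), (5.7)] -/
theorem residueDegree_eq_one_of_closedBall_one_eq_zpow_smul_logUnits_two (hp2 : p = 2)
    (he : absRamificationIdx p K = 1) {k : ℤ} (h : closedBall (0 : K) 1 = ((p : ℚ_[p]) ^ k) • logUnits K) :
    residueDegree p K = 1 ∧ k = -2 := by
  rcases mem_of_closedBall_one_eq_zpow_smul_logUnits_two p K hp2 h with
    ⟨-, h2, -, h4⟩ | ⟨h1, -, -, -⟩ | ⟨h1, -, -, -⟩ | ⟨h1, -, -, -⟩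
  · exact ⟨h2, h4⟩
  all_goals omega

/-- **SUMMARY over all `p`: `e ≥ 2` and `𝒪_K = p^k · log_p(𝒪_K^×)` ⇒ `p ≤ 3`**, with the `p = 3` and `p = 2`
shapes as listed. [cite: NeukirchANT1999, Ch. II (5.7), (7.13)] -/
theorem prime_le_three_of_closedBall_one_eq_zpow_smul_logUnits (he : 2 ≤ absRamificationIdx p K) {k : ℤ}
    (h : closedBall (0 : K) 1 = ((p : ℚ_[p]) ^ k) • logUnits K) : p ≤ 3 := by
  have hp : p.Prime := Fact.out
  by_contra hlt
  push Not at hlt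
  have hp4 : p ≠ 4 := by
    rintro rfl
    exact absurd hp (by decide)
  exact closedBall_one_ne_zpow_smul_logUnits_of_five_le p K (by omega) he k h

end Literature.IUT.LogVolume

end
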